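import Mathlib.LinearAlgebra.Matrix.Determinant.Basic
import Mathlib.RingTheory.Ideal.Span
import Mathlib.LinearAlgebra.Span.Basic
import HarnessLib

/-!
# Determinants with rows in a span (multilinearity, ideal form)

Topic: `Literature/RingTheory/FittingIdeal`. One lemma of linear algebra used in the proof of
Fitting's lemma (`FittingLemma.lean`; The Stacks Project, Tag 07Z8): the determinant is linear
in each row (Mathlib `Matrix.det_updateRow_add`, `Matrix.det_updateRow_smul`), so a determinant
all of whose rows lie in the `R`-span of a set `S` of row vectors lies in the ideal generated by
the determinants of matrices with all rows in `S`. Proved.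

## Sources

* The Stacks Project, Tag 07Z8 (Fitting's lemma), for the use.
* N. Bourbaki, *Algebra I*, Ch. III §8 (multilinearity of the determinant).
-/

namespace Literature.RingTheory.FittingIdeal

universe u

variable {R : Type u} [CommRing R]

/-! ## Determinants with rows in a span -/

/-- **Multilinearity of the determinant in the rows, ideal form**: if every row of a square
matrix `N` lies in the `R`-span of a set `S` of row vectors, then `det N` lies in the ideal
generated by the determinants of the matrices all of whose rows belong to `S`. (Expand row
after row, `Matrix.det_updateRow_add`/`Matrix.det_updateRow_smul`.) [folklore] -/
theorem Matrix.det_mem_span_of_forall_row_mem_span {ι : Type*} [Fintype ι] [DecidableEq ι]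
    (S : Set (ι → R)) (N : Matrix ι ι R) (hN : ∀ i, N i ∈ Submodule.span R S) :
    N.det ∈ Ideal.span {d : R | ∃ V : Matrix ι ι R, (∀ i, V i ∈ S) ∧ V.det = d} := by
  classical
  set J : Ideal R := Ideal.span {d : R | ∃ V : Matrix ι ι R, (∀ i, V i ∈ S) ∧ V.det = d}
  -- induction on the set `K` of rows not yet known to lie in `S`
  suffices h : ∀ (K : Finset ι) (N : Matrix ι ι R), (∀ i, i ∉ K → N i ∈ S) →
      (∀ i, N i ∈ Submodule.span R S) → N.det ∈ J from
    h Finset.univ N (fun i hi => absurd (Finset.mem_univ i) hi) hN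
  intro K
  induction K using Finset.induction_on with
  | empty =>
    intro N hS _
    exact Ideal.subset_span ⟨N, fun i => hS i (Finset.notMem_empty i), rfl⟩
  | insert i K hiK ih =>
    intro N hS hspan
    -- `v ↦ det (N with row i replaced by v)` is linear
    let L : (ι → R) →ₗ[R] R :=
      { toFun := fun v => (N.updateRow i v).det
        map_add' := fun u v => Matrix.det_updateRow_add N i u v
        map_smul' := fun c u => by
          simp only [Matrix.det_updateRow_smul, smul_eq_mul, RingHom.id_apply] }
    have hL : N.det = L (N i) := by
      simp only [L, LinearMap.coe_mk, AddHom.coe_mk, Matrix.updateRow_eq_self]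
    rw [hL]
    have hle : Submodule.span R S ≤ J.comap L := by
      refine Submodule.span_le.mpr fun s hs => ?_
      show (N.updateRow i s).det ∈ J
      refine ih (N.updateRow i s) (fun i' hi' => ?_) (fun i' => ?_)
      · by_cases h : i' = i
        · subst h
          rwa [Matrix.updateRow_self]
        · rw [Matrix.updateRow_ne h]
          exact hS i' (by simp [h, hi'])
      · by_cases h : i' = i
        · subst h
          rw [Matrix.updateRow_self]
          exact Submodule.subset_span hs
        · rw [Matrix.updateRow_ne h]
          exact hspan i'
    exact hle (hspan i)

end Literature.RingTheory.FittingIdeal
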